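import Literature.MathematicalPhysics.QuantumFieldTheory.Balaban1983to89.BlockAxialRepresentative
import Literature.MathematicalPhysics.QuantumFieldTheory.Balaban1983to89.B12GaugeFixInvariance269

/-!
# `Balaban1983to89.BlockAxialRepresentativeCovariance` — [Balaban1987RG1] (2.17) p. 269 «(rU)(b) = U(rb) … By their definitions the
expressions in (2.1) are invariant with respect to these transformations» FOR THE BLOCK-AXIAL REPRESENTATIVE of p. 265 (2.2)–(2.3):
the block-axialiser `axializer cd V` and the block-axial representative `axialize cd V = V^{axializer V}` (module `BlockAxialRepresentative`)
are COVARIANT under the three generators of the Euclidean symmetries of `T^{(j)}` preserving `T^{(j+1)}` — the coarse translations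
`τ_{La}` (`GaugeField.translate (Site.scale a)`), the centre reflections `c_ρ` (`GaugeField.creflect ρ`) and the coordinate permutations
`π` (`GaugeField.permute π`) — whenever the contour datum `cd` transports accordingly; and the tree's concrete averaged contour variables
(0.11) `BlockAveragingTwoLevel.contourData 𝓜` DO transport (module `B12GaugeFixInvariance269`: `holTo_translate`, `holTo_creflect_of_blockOf`
letter by letter, `holTo_permute_of_adm` on admissible staircase families), so the covariance holds for them: unconditionally for
translations and centre reflections, on the admissible (small-field) domain for permutations.

CITATION HEADER.  T. Bałaban, *Renormalization group approach to lattice gauge field theories. I*, Commun. Math. Phys. **109** (1987)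
249–301 [Balaban1987RG1]: (2.17) p. 269; p. 265 (2.2)–(2.3) («choosing the element of the orbit satisfying the axial gauge conditions»);
p. 263 («Other symmetries are Euclidean lattice transformations … we notice that the explicitly defined expressions … are invariant»);
(0.11) p. 253 (averaged contour variables).  Porter PT-A-2 (`ymgap-nodeO-port-PTA-2`), row S5-0 (ii) of its PORT-PLAN (the Euclidean
half of the symmetry hub feeding §5 (5.4)–(5.8) p. 292), FILE E1.

WHAT IS PROVED ([folklore] bookkeeping over the tree's carriers; every item by `funext` and the cited transport lemmas).
§1 the three symmetry maps intertwine gauge transformations: `translate_gaugeAct`, `permute_gaugeAct`, `creflect_gaugeAct`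
(`(U^u) ∘ r = (U ∘ r)^{u ∘ r}`).  §2 generic over a contour datum `cd` under a DISPLAYED transport hypothesis on `cd.holTo` at the pairs
`(blockOf x, x)`: `axializer_translate ∕ axialize_translate`, `axializer_permute ∕ axialize_permute`, `axializer_creflect ∕ axialize_creflect`.
§3 the instances at `BlockAveragingTwoLevel.contourData 𝓜`: `axialize_contourData_translate`, `axialize_contourData_creflect` (no
hypothesis), `axialize_contourData_permute_of_adm` (admissible staircase families at the pairs `(blockOf x, x)`).

HONEST FRAMING.  Symmetry bookkeeping of a normalisation map; nothing of Bałaban's analysis is asserted, ported or discharged; no `sorry`,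
standard axioms; the Yang–Mills mass gap (Clay) is NOT proved by any of this.
-/

noncomputable section

namespace Literature.MathematicalPhysics.QuantumFieldTheory.Balaban1983to89.BlockAxialRepresentative

open GaugeField (gaugeAct)
open BlockAveragingTwoLevel B12GaugeFixInvariance269 T4Continuum

variable {P : Params} {j : ℕ} {G : Type*} [GaugeGroup G]

/-! ## §1. The symmetry maps (2.17) intertwine gauge transformations -/

/-- `(U^u) ∘ τ_a = (U ∘ τ_a)^{u ∘ τ_a}`. [cite: Balaban1987RG1, (2.17) p.269] -/
theorem translate_gaugeAct (a : Site P j) (u : GaugeTransf P j G) (U : GaugeField P j G) :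
    (gaugeAct u U).translate a = gaugeAct (fun x => u (x + a)) (U.translate a) := by
  funext b
  simp only [GaugeField.translate_apply, gaugeAct, PBond.translate_tgt]
  rfl

/-- `(U^u) ∘ π = (U ∘ π)^{u ∘ π}`. [cite: Balaban1987RG1, (2.17) p.269] -/
theorem permute_gaugeAct (π : Equiv.Perm (Fin P.d)) (u : GaugeTransf P j G) (U : GaugeField P j G) :
    (gaugeAct u U).permute π = gaugeAct (fun x => u (x.permute π)) (U.permute π) := by
  funext b
  simp only [GaugeField.permute_apply, gaugeAct, PBond.permute_tgt, PBond.permute_src]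

/-- The centre-reflected site `c_ρ x = r_ρ x − e_ρ` is the reflected site translated by `−e_ρ` (the label map of (2.17)'s centre reflection, cf. `T4Covariance.GaugeField.creflect_eq`). [cite: Balaban1987RG1, (2.17) p.269 (bookkeeping)] -/
theorem creflectSite_eq_reflect_add (ρ : Fin P.d) (x : Site P j) :
    (x.reflect ρ).unshift ρ = x.reflect ρ + (0 : Site P j).unshift ρ := by
  funext ν
  simp only [Site.add_apply, Site.unshift_apply, Site.reflect_apply]
  by_cases h : ν = ρ
  · subst h; simp only [if_true]; rw [show (0 : Site P j) ν = 0 from rfl]; ring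
  · simp only [if_neg h]; rw [show (0 : Site P j) ν = 0 from rfl]; ring

/-- `(U^u) ∘ c_ρ = (U ∘ c_ρ)^{u ∘ c_ρ}` for the centre reflection `c_ρ` (`T4Covariance.GaugeField.creflect`). [cite: Balaban1987RG1, (2.17) p.269] -/
theorem creflect_gaugeAct (ρ : Fin P.d) (u : GaugeTransf P j G) (U : GaugeField P j G) :
    (gaugeAct u U).creflect ρ = gaugeAct (fun x => u ((x.reflect ρ).unshift ρ)) (U.creflect ρ) := by
  rw [GaugeField.creflect_eq, GaugeField.creflect_eq, translate_gaugeAct, GaugeField.reflect_gaugeAct]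
  congr 1
  funext x
  rw [creflectSite_eq_reflect_add]

/-! ## §2. Covariance of the block-axialiser and of the block-axial representative, generic over the contour datum -/

section Generic

variable (cd : ContourData P j G)

/-- **`axializer (τ_{La}V) = (axializer V) ∘ τ_{La}`** when the contour datum transports under the coarse translation at the pairs
`(blockOf x, x)`. [cite: Balaban1987RG1, (2.17) p.269, p.265 (2.3)] -/
theorem axializer_translate (hj : j + 1 ≤ P.m + P.K) (a : Site P (j + 1)) (V : GaugeField P j G)
    (hcd : ∀ x : Site P j, cd.holTo (V.translate (Site.scale a)) (blockOf x) x = cd.holTo V (blockOf x + a) (x + Site.scale a))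
    (x : Site P j) : axializer cd (V.translate (Site.scale a)) x = axializer cd V (x + Site.scale a) := by
  unfold axializer
  rw [blockOf_add_scale hj x a, Site.emb_add]
  by_cases h : x = emb (blockOf x)
  · rw [if_pos h, if_pos (by rw [← h])]
  · rw [if_neg h, if_neg (fun h' => h ((add_left_inj _).1 h')), hcd x]

/-- **`axialize (τ_{La}V) = τ_{La} (axialize V)`**. [cite: Balaban1987RG1, (2.17) p.269, p.265 (2.3)] -/
theorem axialize_translate (hj : j + 1 ≤ P.m + P.K) (a : Site P (j + 1)) (V : GaugeField P j G)
    (hcd : ∀ x : Site P j, cd.holTo (V.translate (Site.scale a)) (blockOf x) x = cd.holTo V (blockOf x + a) (x + Site.scale a)) :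
    axialize cd (V.translate (Site.scale a)) = (axialize cd V).translate (Site.scale a) := by
  rw [axialize_def, axialize_def, translate_gaugeAct]
  congr 1
  funext x
  exact axializer_translate cd hj a V hcd x

/-- **`axializer (πV) = (axializer V) ∘ π`** when the contour datum transports under the coordinate permutation at the pairs `(blockOf x, x)`.
[cite: Balaban1987RG1, (2.17) p.269, p.265 (2.3)] -/
theorem axializer_permute (π : Equiv.Perm (Fin P.d)) (V : GaugeField P j G)
    (hcd : ∀ x : Site P j, cd.holTo (V.permute π) (blockOf x) x = cd.holTo V ((blockOf x).permute π) (x.permute π))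
    (x : Site P j) : axializer cd (V.permute π) x = axializer cd V (x.permute π) := by
  unfold axializer
  rw [blockOf_permute, emb_permute]
  by_cases h : x = emb (blockOf x)
  · rw [if_pos h, if_pos (by rw [← h])]
  · rw [if_neg h, if_neg (fun h' => h ((permute_inj π).1 h')), hcd x]

/-- **`axialize (πV) = π (axialize V)`**. [cite: Balaban1987RG1, (2.17) p.269, p.265 (2.3)] -/
theorem axialize_permute (π : Equiv.Perm (Fin P.d)) (V : GaugeField P j G)
    (hcd : ∀ x : Site P j, cd.holTo (V.permute π) (blockOf x) x = cd.holTo V ((blockOf x).permute π) (x.permute π)) :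
    axialize cd (V.permute π) = (axialize cd V).permute π := by
  rw [axialize_def, axialize_def, permute_gaugeAct]
  congr 1
  funext x
  exact axializer_permute cd π V hcd x

/-- **`axializer (c_ρV) = (axializer V) ∘ c_ρ`** when the contour datum transports under the centre reflection at the pairs `(blockOf x, x)`.
[cite: Balaban1987RG1, (2.17) p.269, p.265 (2.3)] -/
theorem axializer_creflect (hj : j + 1 ≤ P.m + P.K) (ρ : Fin P.d) (V : GaugeField P j G)
    (hcd : ∀ x : Site P j, cd.holTo (V.creflect ρ) (blockOf x) x =
      cd.holTo V (((blockOf x).reflect ρ).unshift ρ) ((x.reflect ρ).unshift ρ))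
    (x : Site P j) : axializer cd (V.creflect ρ) x = axializer cd V ((x.reflect ρ).unshift ρ) := by
  unfold axializer
  rw [blockOf_creflect hj x ρ, Site.emb_creflect]
  by_cases h : x = emb (blockOf x)
  · rw [if_pos h, if_pos (by rw [← h])]
  · rw [if_neg h, if_neg (fun h' => h ((creflectSite_inj ρ).1 h')), hcd x]

/-- **`axialize (c_ρV) = c_ρ (axialize V)`**. [cite: Balaban1987RG1, (2.17) p.269, p.265 (2.3)] -/
theorem axialize_creflect (hj : j + 1 ≤ P.m + P.K) (ρ : Fin P.d) (V : GaugeField P j G)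
    (hcd : ∀ x : Site P j, cd.holTo (V.creflect ρ) (blockOf x) x =
      cd.holTo V (((blockOf x).reflect ρ).unshift ρ) ((x.reflect ρ).unshift ρ)) :
    axialize cd (V.creflect ρ) = (axialize cd V).creflect ρ := by
  rw [axialize_def, axialize_def, creflect_gaugeAct]
  congr 1
  funext x
  exact axializer_creflect cd hj ρ V hcd x

end Generic

/-! ## §3. The instances at the averaged contour variables (0.11) `BlockAveragingTwoLevel.contourData 𝓜` -/

section ContourDataInst

variable (𝓜 : GroupAverage G)

/-- **THE BLOCK-AXIAL REPRESENTATIVE OVER (0.11) IS TRANSLATION COVARIANT**, unconditionally. [cite: Balaban1987RG1, (2.17) p.269, (0.11) p.253] -/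
theorem axialize_contourData_translate (hj : j + 1 ≤ P.m + P.K) (a : Site P (j + 1)) (V : GaugeField P j G) :
    axialize (contourData 𝓜) (V.translate (Site.scale a)) = (axialize (contourData 𝓜) V).translate (Site.scale a) :=
  axialize_translate _ hj a V fun x => holTo_translate 𝓜 (blockOf x) a V x

/-- **THE BLOCK-AXIAL REPRESENTATIVE OVER (0.11) IS COVARIANT UNDER THE CENTRE REFLECTIONS**, unconditionally. [cite: Balaban1987RG1, (2.17) p.269, (0.11) p.253] -/
theorem axialize_contourData_creflect (hj : j + 1 ≤ P.m + P.K) (ρ : Fin P.d) (V : GaugeField P j G) :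
    axialize (contourData 𝓜) (V.creflect ρ) = (axialize (contourData 𝓜) V).creflect ρ :=
  axialize_creflect _ hj ρ V fun x => holTo_creflect_of_blockOf 𝓜 hj ρ V (blockOf x) x rfl

/-- **THE BLOCK-AXIAL REPRESENTATIVE OVER (0.11) IS COVARIANT UNDER THE COORDINATE PERMUTATIONS ON THE ADMISSIBLE DOMAIN** — every staircase
family of `V` from a block centre to a point of its block admissible for the group average `𝓜` (the small-field domain on which (0.11) is
the printed average). [cite: Balaban1987RG1, (2.17) p.269, (0.11) p.253] -/
theorem axialize_contourData_permute_of_adm (π : Equiv.Perm (Fin P.d)) (V : GaugeField P j G)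
    (hadm : ∀ x : Site P j, 𝓜.Adm (stairHol V (blockOf x) (offsetOf (blockOf x) x))) :
    axialize (contourData 𝓜) (V.permute π) = (axialize (contourData 𝓜) V).permute π :=
  axialize_permute _ π V fun x => by
    have h := hadm (x.permute π)
    rw [blockOf_permute] at h
    exact holTo_permute_of_adm 𝓜 π V (blockOf x) x h

end ContourDataInst

end Literature.MathematicalPhysics.QuantumFieldTheory.Balaban1983to89.BlockAxialRepresentative

end
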